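import Summits.NavierStokesRegularity.NavierStokesRegularity.Theses.WakeRatchet

/-!
# Route `WakeRatchet` — the O-2 KILL CRITERION for the per-shell rate cruxes, typed
# (⟨stmt-NavierStokesRegularity-25646⟩ `EternalInviscidRate`, ⟨25647⟩ `EternalViscousRate`, parent ⟨25584⟩ `TailRateRatchet`)

Instrument E-g10-2 / E-g10-3 (evidence RESULT-E-g10-2.md, RESULT-E-g10-3.md on ⟨25646⟩; certified table `tao2rot ∈ E₂(4)`, kit
j320471 / j321929 / j325154) reads OBSERVATION O-2 on cascading fronts: the PER-SHELL tail-envelope rate `a_n := −log_λ(Θ_{n+1}/Θ_n)`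
(`Θ_n = sup_σ Σ_{k≥0} E_{n+k}(σ)`, `λ = 1+ε₀`) dips BELOW `1` at a positive fraction of shells (`a_min = 0.82 @ ε₀=1/16`, `0.38 @ 1/32`),
while block rates stay `> 1`.  The tree types the kill criteria of the per-shell rate cruxes in two witness shapes so far — a CONVEYOR
(`FinalWakeLedger.not_eternalInviscidRate_of_conveyors`) and a SURVIVING DSS WAVE (`WakeRatchetDSS.EternalInviscidRate_false_of_survivingDSSWaves`).
This file adds the third, the one O-2 points at: a RATE DIP.

* `EternalInviscidRate_false_of_rateDip` — if ONE fixed class `E₂(R)` carries, at arbitrarily small scale ratios, a uniformly bounded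
  admissible INVISCID eternal solution with a shell `n`, a bound `M` on the tail above `n` at all log-times, and a log-time at which the tail
  above `n+1` exceeds `(1+ε₀)^{−1}·M` (per-shell rate `< 1` at shell `n` against the envelope `M`), then `¬ EternalInviscidRate`.
* `EternalViscousRate_false_of_rateDip` — the same for the dissipation-balanced slice (`IsEternalVisc ε₀ ν̂ α W`, `ν̂ > 0`) and ⟨25647⟩.
* `TailRateRatchet_false_of_rateDip` — the same for the parent ⟨25584⟩ (any `ν̂`).
Why the threshold `(1+ε₀)^{−1}` suffices against EVERY exponent `a > 1` of the crux: `(1+ε₀)^{−a} ≤ (1+ε₀)^{−1}` and `M ≥ 0`.  The existence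
hypothesis is NOT supplied by the tree (no bounded admissible eternal solution of a fixed-spread backscattering table is constructed; O-2 is a
reading on finite cascades); no verdict changes.  HONEST LABEL: bookkeeping; no registered stub is closed; MODEL lattice only (Tao 2016 §4
renormalised cascade); nothing here bears on the Navier–Stokes equations or the summit.
[cite: Tao2016AveragedNS, §4 Lemma 4.1 (4.8)–(4.10), Thm. 4.2 (statement shape), §6.4]
-/

noncomputable section

set_option linter.dupNamespace false

open Filter Topology
open Literature.Analysis.FluidPDE.TaoCascade

namespace Summit.NavierStokesRegularity.NavierStokesRegularity.Theorems

namespace WakeRatchetRateDip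

/-- `(1+ε₀)^{−a}·M ≤ (1+ε₀)^{−1}·M` for `a > 1`, `ε₀ > 0`, `M ≥ 0`. [cite: Tao2016AveragedNS, §4 (scale ratio `1+ε₀`); elementary] -/
theorem rpow_neg_mul_le {ε₀ a M : ℝ} (hε : 0 < ε₀) (ha : 1 < a) (hM : 0 ≤ M) :
    (1 + ε₀) ^ (-a) * M ≤ (1 + ε₀) ^ (-(1 : ℝ)) * M := by
  have h1 : 1 < 1 + ε₀ := by linarith
  have hle : (1 + ε₀) ^ (-a) ≤ (1 + ε₀) ^ (-(1 : ℝ)) :=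
    (Real.rpow_lt_rpow_of_exponent_lt h1 (by linarith)).le
  exact mul_le_mul_of_nonneg_right hle hM

/-- **O-2 kill criterion for ⟨25646⟩.**  A family of RATE-DIP witnesses on ONE class `E₂(R)` at arbitrarily small scale ratios —
a uniformly bounded admissible inviscid eternal solution, a shell `n`, an envelope `M` of the tail above `n`, and a log-time where the tail
above `n+1` exceeds `(1+ε₀)^{−1}·M` — refutes `WakeRatchet.EternalInviscidRate`.  The hypothesis is NOT supplied by the tree.  MODEL lattice only.
[cite: Tao2016AveragedNS, §4 Lemma 4.1 (4.8)–(4.10), Thm. 4.2 (statement shape), §6.4] -/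
theorem EternalInviscidRate_false_of_rateDip {R : ℝ} (hR : 1 ≤ R)
    (h : ∀ εs : ℝ, 0 < εs → ∃ ε₀ : ℝ, 0 < ε₀ ∧ ε₀ ≤ εs ∧
      ∃ α : Fin 4 → Fin 4 → Fin 4 → ℤ × ℤ × ℤ → ℝ, InTableClass R α ∧
      ∃ W : ℤ → ℝ → Em 4, IsEternal ε₀ α W ∧ UniformBound W ∧
      ∃ (n : ℤ) (M : ℝ), (∀ σ : ℝ, ∑' k : ℕ, physEnergy ε₀ W (n + k) σ ≤ M) ∧
        ∃ σ : ℝ, (1 + ε₀) ^ (-(1 : ℝ)) * M < ∑' k : ℕ, physEnergy ε₀ W (n + 1 + k) σ) :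
    ¬ Summit.NavierStokesRegularity.NavierStokesRegularity.Theses.WakeRatchet.EternalInviscidRate := by
  intro hK
  obtain ⟨a, ha, εs, hεs, H⟩ := hK R hR
  obtain ⟨ε₀, hε, hεle, α, hα, W, hW, hU, n, M, hM, σ, hdip⟩ := h εs hεs
  have hM0 : 0 ≤ M := (tsum_nonneg fun k => physEnergy_nonneg _ _ _ _).trans (hM σ)
  have h1 := H ε₀ hε hεle α hα W hW hU n M hM σ
  exact absurd (h1.trans (rpow_neg_mul_le hε ha hM0)) (not_le.mpr hdip)

/-- **O-2 kill criterion for ⟨25647⟩** (dissipation-balanced slice, `ν̂ > 0`): rate-dip witnesses among uniformly bounded admissible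
eternal solutions WITH covariant viscosity on one class `E₂(R)` at arbitrarily small scale ratios refute `WakeRatchet.EternalViscousRate`.
The hypothesis is NOT supplied by the tree.  MODEL lattice only.
[cite: Tao2016AveragedNS, §4, the viscous equation before Thm. 4.2, Lemma 4.1 (4.8)–(4.10), §6.4] -/
theorem EternalViscousRate_false_of_rateDip {R : ℝ} (hR : 1 ≤ R)
    (h : ∀ εs : ℝ, 0 < εs → ∃ ε₀ : ℝ, 0 < ε₀ ∧ ε₀ ≤ εs ∧
      ∃ α : Fin 4 → Fin 4 → Fin 4 → ℤ × ℤ × ℤ → ℝ, InTableClass R α ∧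
      ∃ (νh : ℝ) (W : ℤ → ℝ → Em 4), 0 < νh ∧ IsEternalVisc ε₀ νh α W ∧ UniformBound W ∧
      ∃ (n : ℤ) (M : ℝ), (∀ σ : ℝ, ∑' k : ℕ, physEnergy ε₀ W (n + k) σ ≤ M) ∧
        ∃ σ : ℝ, (1 + ε₀) ^ (-(1 : ℝ)) * M < ∑' k : ℕ, physEnergy ε₀ W (n + 1 + k) σ) :
    ¬ Summit.NavierStokesRegularity.NavierStokesRegularity.Theses.WakeRatchet.EternalViscousRate := by
  intro hK
  obtain ⟨a, ha, εs, hεs, H⟩ := hK R hR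
  obtain ⟨ε₀, hε, hεle, α, hα, νh, W, hν, hW, hU, n, M, hM, σ, hdip⟩ := h εs hεs
  have hM0 : 0 ≤ M := (tsum_nonneg fun k => physEnergy_nonneg _ _ _ _).trans (hM σ)
  have h1 := H ε₀ hε hεle α hα νh W hν hW hU n M hM σ
  exact absurd (h1.trans (rpow_neg_mul_le hε ha hM0)) (not_le.mpr hdip)

/-- **O-2 kill criterion for the parent ⟨25584⟩** (`TailRateRatchet`, any covariant viscosity `ν̂`): rate-dip witnesses on one class
`E₂(R)` at arbitrarily small scale ratios refute it.  The hypothesis is NOT supplied by the tree.  MODEL lattice only.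
[cite: Tao2016AveragedNS, §4 Lemma 4.1 (4.8)–(4.10), Thm. 4.2 (statement shape), §6.4] -/
theorem TailRateRatchet_false_of_rateDip {R : ℝ} (hR : 1 ≤ R)
    (h : ∀ εs : ℝ, 0 < εs → ∃ ε₀ : ℝ, 0 < ε₀ ∧ ε₀ ≤ εs ∧
      ∃ α : Fin 4 → Fin 4 → Fin 4 → ℤ × ℤ × ℤ → ℝ, InTableClass R α ∧
      ∃ (νh : ℝ) (W : ℤ → ℝ → Em 4), IsEternalVisc ε₀ νh α W ∧ UniformBound W ∧
      ∃ (n : ℤ) (M : ℝ), (∀ σ : ℝ, ∑' k : ℕ, physEnergy ε₀ W (n + k) σ ≤ M) ∧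
        ∃ σ : ℝ, (1 + ε₀) ^ (-(1 : ℝ)) * M < ∑' k : ℕ, physEnergy ε₀ W (n + 1 + k) σ) :
    ¬ Summit.NavierStokesRegularity.NavierStokesRegularity.Theses.WakeRatchet.TailRateRatchet := by
  intro hK
  obtain ⟨a, ha, εs, hεs, H⟩ := hK R hR
  obtain ⟨ε₀, hε, hεle, α, hα, νh, W, hW, hU, n, M, hM, σ, hdip⟩ := h εs hεs
  have hM0 : 0 ≤ M := (tsum_nonneg fun k => physEnergy_nonneg _ _ _ _).trans (hM σ)
  have h1 := H ε₀ hε hεle α hα νh W hW hU n M hM σ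
  exact absurd (h1.trans (rpow_neg_mul_le hε ha hM0)) (not_le.mpr hdip)

end WakeRatchetRateDip

end Summit.NavierStokesRegularity.NavierStokesRegularity.Theorems

end
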